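import Summits.BirchSwinnertonDyer.BirchSwinnertonDyer.Theorems.GenusKolyvaginAtTwoMinimalTwinBSDTwoKrizLiAnchorWall
import HarnessLib

/-!
# Route `GenusKolyvaginAtTwo`, crux U₂ `MinimalTwinBSDTwo` (stmt-BirchSwinnertonDyer-22985), LINE 23 «twin_swap»: THE U₂-KEYED SORTING OF THE KRIZ–LI
# PRINT ROAD AT A RANK-**ZERO** (★)-ANCHOR — for a non-CM anchor `V` of analytic rank `0` with BOTH `N(V) < 5000` and `N(V^{(d_K)}) < 5000`
# (Creutz–Miller on the pair), the RANK-ONE half of the packet is the set of companions `V^{(d·d_K)}` (`d ∈ 𝒩(V, K)`, `χ_d(−N) = 1`) together with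
# the partner `V^{(d_K)}` itself: all of them are non-CM curves of analytic rank ONE (U₂'s class) with `BSD(·, 2)` FROM PRINT ALONE — no wall row, no LINE 23 stub

Seat `bsd-line-gk2-p2` g35 (PROVER 2/3, cell `bsd-f1-sign2`; LINE 23 holder), `--supports stmt-BirchSwinnertonDyer-22985` (helper; closes nothing).
THEOREMS ONLY (0 `def`, 0 `sorry`); standard axioms; base-generic, field-generic.  HONEST FRAMING (D-0014/D-0036): the K4 seat's generic print road
`AddPotGoodPrint.krizLi_bsdp_two_of_twist_of_conductor_lt` (cell `bsd-2adic`; no rank input, both numerical `BSD(2)` inputs from Creutz–Miller) gives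
`BSD(·, 2)` on the whole packet; its own sorting `printFamilyKrizLi_rankOne/rankZero` is keyed on the ADDITIVE habitat (`Addv V 2`, for K4).  This
file is the habitat-free sorting U₂ wants (companion of this lineage's `rankOneMembers_of_wall` / `rankZeroCompanions_of_wall`, g34, which sort the
packet of a rank-ONE anchor): from the displayed `r_an(V) = 0` (Cremona's table / the caption «rank zero curves» of Kriz–Li's Table 2; for `11a1` a
TREE THEOREM mod modularity, `Curve11a.analyticRank_eq_zero_of_modularity`) and `¬CM(V)`,
* §1 `rankOneCompanions_of_partner_conductor_lt` — at every global minimal `W₂ ≅ V^{(d·d_K)}`: `r_an(W₂) = 1 ∧ ¬CM ∧ BSDp W₂ 2` (Thm 4.3 at `d`: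
  `r_an(V^{(d)}) = r_an(V) = 0`, so the other member has rank one);
* §1 `rankZeroMembers_of_partner_conductor_lt` — at every global minimal `W₁ ≅ V^{(d)}`: `r_an(W₁) = 0 ∧ ¬CM ∧ BSDp W₁ 2`;
* §2 `rankOnePartner_of_conductor_lt` — the partner `W₀ ≅ V^{(d_K)}` itself: `r_an(W₀) = 1 ∧ ¬CM ∧ BSDp W₀ 2` (Thm 4.3 at `d = 1` + Creutz–Miller).
Instances (this seat): the three rank-zero rows of Kriz–Li's Table 2 that are good at `2` with `c₂` odd and `49·N < 5000` — `11a1`, `37b1`, `67a1`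
(`…KrizLiAnchor11a1/37b1/67a1.lean`).  CONDITIONAL on the displayed PRINT facts (`hKL` Thm 5.1 (2), `h33` Thm 4.3, `hS31` Creutz–Miller) and the
anchor's (★)-datum; **BSD is NOT proved by any of this; U₂ is NOT proved; no item is closed.**

References: [KrizLi2019] Thm 5.1 (2) (FMS VoR p. 30) = arXiv:1606.03172 Thm 1.12, Thm 4.3, Def 4.1, Rem. 5.2, §6 Ex. 6.4–6.5 and Table 2;
[CreutzMiller2012] Thm 1.1; [Miller2011LMS] Def 1.1; [SilvermanAEC2009] X.5, App. C §11.
-/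

set_option autoImplicit false
-- the Theorems namespace of this sub repeats the summit name by design (D-0017 nested layout)
set_option linter.dupNamespace false

noncomputable section

open scoped Classical

open WeierstrassCurve NumberField Literature.NumberTheory.EllipticCurves
  Literature.NumberTheory.EllipticCurves.ModularForms
  Literature.NumberTheory.EllipticCurves.Rank1Residual
  Literature.NumberTheory.EllipticCurves.Rank1Residual.Typed
  Summit.BirchSwinnertonDyer.Rank1Residual
  Summit.BirchSwinnertonDyer.Rank1Residual.P2
  Summit.BirchSwinnertonDyer.BirchSwinnertonDyer.Theorems.AddPotGoodPrint

namespace Summit.BirchSwinnertonDyer.BirchSwinnertonDyer.Theorems.GenusExact.TwinSwap.KrizLiAnchorWall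

variable (V : WeierstrassCurve ℚ) [V.IsElliptic] [V.IsGloballyMinimal] [NeZero (V.conductorNorm ℤ)]

/-! ## §1 The packet of a rank-zero anchor: rank-one companions `V^{(d·d_K)}`, rank-zero members `V^{(d)}` -/

/-- ★ **THE RANK-ONE COMPANIONS `V^{(d·d_K)}` OF A RANK-ZERO (★)-ANCHOR — U₂-CLASS CURVES SETTLED BY PRINT ALONE**: for a non-CM anchor `V` with
`r_an(V) = 0` (displayed), `V(ℚ)[2] = 0`, `N(V) < 5000`, a Heegner field `K`, the (★)-datum, Kriz–Li's local clause, and SOME global minimal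
`W₀ ≅ V^{(d_K)}` with `N(W₀) < 5000`: at every global minimal `W₂ ≅ V^{(d·d_K)}` (`d ∈ 𝒩(V, K)`, `χ_d(−N) = 1`):
`r_an(W₂) = 1 ∧ ¬CM(W₂) ∧ BSD(W₂, 2)`.  BY NAME: Thm 5.1 (2) (`hKL`), Thm 4.3 (`h33`), Creutz–Miller (`hS31`).  No wall, no LINE 23 stub.
BSD is not proved by any of this; U₂ is not proved. [cite: KrizLi2019, Thm. 5.1 (2), Thm. 4.3, §6 Example 6.4] [cite: CreutzMiller2012, Thm. 1.1] [cite: Miller2011LMS, Def. 1.1] -/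
theorem rankOneCompanions_of_partner_conductor_lt (hKL : KrizLi2019.thm112_bsdTwo_twist)
    (h33 : KrizLi2019.thm33_rank_twist) (hS31 : bsdTriple_of_analyticRank_le_one_of_conductor_lt)
    (hN : V.conductorNorm ℤ < 5000) (hcm : ¬ V.HasCM) (hr : V.analyticRank = 0)
    (h2 : ∀ Q : V.toAffine.Point, 2 • Q = 0 → Q = 0)
    (K : Type) [Field K] [NumberField K] (hK : IsImaginaryQuadratic K) (hH : SatisfiesHeegnerHypothesis (V.conductorNorm ℤ) K)
    (Dt : ModularParametrizationData V (V.conductorNorm ℤ)) (H : HeegnerDatum (V.conductorNorm ℤ) (NumberField.discr K))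
    (ι : K →+* ℂ) (P : (V.baseChange K).toAffine.Point) (hP : WeierstrassCurve.Affine.Point.map ι.toRatAlgHom P = heegnerPointComplex Dt H)
    (j : K →ₐ[ℚ] ℚ_[2]) (hstar : KrizLi2019.AssumptionStar V Dt K P j)
    (hloc : (haveI : Fact (2 : ℕ).Prime := ⟨Nat.prime_two⟩;
      Odd ((V.baseChange ℚ_[2]).localTamagawaNumber ℤ_[2]) ∧
        (¬ V.HasGoodReductionAtPrime 2 → ¬ V.HasMultiplicativeReductionAtPrime 2 → Odd Dt.c)))
    (W₀ : WeierstrassCurve ℚ) [W₀.IsElliptic] [W₀.IsGloballyMinimal]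
    (hW₀ : ∃ C : VariableChange ℚ, C • V.quadraticTwist (NumberField.discr K : ℚ) = W₀) (hN₀ : W₀.conductorNorm ℤ < 5000)
    {d : ℤ} (hd : KrizLi2019.InN V K d) (hsign : Int.sign d * jacobiSym (V.conductorNorm ℤ) d.natAbs = 1)
    (W₂ : WeierstrassCurve ℚ) [W₂.IsElliptic] [W₂.IsGloballyMinimal]
    (hW₂ : ∃ C : VariableChange ℚ, C • V.quadraticTwist ((d * NumberField.discr K : ℤ) : ℚ) = W₂) :
    W₂.analyticRank = 1 ∧ ¬ W₂.HasCM ∧ BSDp W₂ 2 := by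
  have hB : BSDp W₂ 2 := krizLi_bsdp_two_of_twist_of_conductor_lt V hKL h33 hS31 hN h2 K hK hH Dt H ι P hP j hstar hloc W₀ hW₀ hN₀
    hd hsign W₂ (Or.inr hW₂)
  have hD : (NumberField.discr K : ℚ) ≠ 0 := by exact_mod_cast NumberField.discr_ne_zero K
  have hd0 : (d : ℚ) ≠ 0 := cast_ne_zero_of_inN V hd
  have hdK0 : ((d * NumberField.discr K : ℤ) : ℚ) ≠ 0 := by push_cast; exact mul_ne_zero hd0 hD
  obtain ⟨W₁, _, _, hW₁⟩ := exists_globallyMinimal_twist V hd0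
  obtain ⟨hor, heq⟩ := krizLi_analyticRank_twists V h33 h2 K hK hH Dt H ι P hP j hstar hd hsign W₁ W₂ hW₁ hW₂
  have hr2 : W₂.analyticRank = 1 := by omega
  exact ⟨hr2, not_hasCM_of_smul_quadraticTwist V hcm hdK0 W₂ hW₂, hB⟩

/-- **THE RANK-ZERO MEMBERS `V^{(d)}` OF A RANK-ZERO (★)-ANCHOR, settled by print alone**: same data; at every global minimal `W₁ ≅ V^{(d)}`
(`d ∈ 𝒩(V, K)`, `χ_d(−N) = 1`): `r_an(W₁) = 0 ∧ ¬CM(W₁) ∧ BSD(W₁, 2)`.  BSD is not proved by any of this.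
[cite: KrizLi2019, Thm. 5.1 (2), Thm. 4.3, §6 Example 6.4] [cite: CreutzMiller2012, Thm. 1.1] [cite: Miller2011LMS, Def. 1.1] -/
theorem rankZeroMembers_of_partner_conductor_lt (hKL : KrizLi2019.thm112_bsdTwo_twist)
    (h33 : KrizLi2019.thm33_rank_twist) (hS31 : bsdTriple_of_analyticRank_le_one_of_conductor_lt)
    (hN : V.conductorNorm ℤ < 5000) (hcm : ¬ V.HasCM) (hr : V.analyticRank = 0)
    (h2 : ∀ Q : V.toAffine.Point, 2 • Q = 0 → Q = 0)
    (K : Type) [Field K] [NumberField K] (hK : IsImaginaryQuadratic K) (hH : SatisfiesHeegnerHypothesis (V.conductorNorm ℤ) K)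
    (Dt : ModularParametrizationData V (V.conductorNorm ℤ)) (H : HeegnerDatum (V.conductorNorm ℤ) (NumberField.discr K))
    (ι : K →+* ℂ) (P : (V.baseChange K).toAffine.Point) (hP : WeierstrassCurve.Affine.Point.map ι.toRatAlgHom P = heegnerPointComplex Dt H)
    (j : K →ₐ[ℚ] ℚ_[2]) (hstar : KrizLi2019.AssumptionStar V Dt K P j)
    (hloc : (haveI : Fact (2 : ℕ).Prime := ⟨Nat.prime_two⟩;
      Odd ((V.baseChange ℚ_[2]).localTamagawaNumber ℤ_[2]) ∧
        (¬ V.HasGoodReductionAtPrime 2 → ¬ V.HasMultiplicativeReductionAtPrime 2 → Odd Dt.c)))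
    (W₀ : WeierstrassCurve ℚ) [W₀.IsElliptic] [W₀.IsGloballyMinimal]
    (hW₀ : ∃ C : VariableChange ℚ, C • V.quadraticTwist (NumberField.discr K : ℚ) = W₀) (hN₀ : W₀.conductorNorm ℤ < 5000)
    {d : ℤ} (hd : KrizLi2019.InN V K d) (hsign : Int.sign d * jacobiSym (V.conductorNorm ℤ) d.natAbs = 1)
    (W₁ : WeierstrassCurve ℚ) [W₁.IsElliptic] [W₁.IsGloballyMinimal]
    (hW₁ : ∃ C : VariableChange ℚ, C • V.quadraticTwist (d : ℚ) = W₁) :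
    W₁.analyticRank = 0 ∧ ¬ W₁.HasCM ∧ BSDp W₁ 2 := by
  have hB : BSDp W₁ 2 := krizLi_bsdp_two_of_twist_of_conductor_lt V hKL h33 hS31 hN h2 K hK hH Dt H ι P hP j hstar hloc W₀ hW₀ hN₀
    hd hsign W₁ (Or.inl hW₁)
  have hD : (NumberField.discr K : ℚ) ≠ 0 := by exact_mod_cast NumberField.discr_ne_zero K
  have hd0 : (d : ℚ) ≠ 0 := cast_ne_zero_of_inN V hd
  have hdK0 : ((d * NumberField.discr K : ℤ) : ℚ) ≠ 0 := by push_cast; exact mul_ne_zero hd0 hD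
  obtain ⟨W₂, _, _, hW₂⟩ := exists_globallyMinimal_twist V hdK0
  obtain ⟨-, heq⟩ := krizLi_analyticRank_twists V h33 h2 K hK hH Dt H ι P hP j hstar hd hsign W₁ W₂ hW₁ hW₂
  exact ⟨by rw [heq, hr], not_hasCM_of_smul_quadraticTwist V hcm hd0 W₁ hW₁, hB⟩

/-! ## §2 The partner `V^{(d_K)}` itself -/

/-- **THE PARTNER `W₀ ≅ V^{(d_K)}` OF A RANK-ZERO (★)-ANCHOR is a U₂-class curve settled by print**: `r_an(W₀) = 1` (Thm 4.3 at `d = 1`),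
`¬CM(W₀)`, and `BSD(W₀, 2)` (Creutz–Miller at `N(W₀) < 5000`, `r_an ≤ 1`).  BSD is not proved by any of this.
[cite: KrizLi2019, Thm. 4.3 and §6 Example 6.4] [cite: CreutzMiller2012, Thm. 1.1] [cite: Miller2011LMS, Def. 1.1] -/
theorem rankOnePartner_of_conductor_lt (h33 : KrizLi2019.thm33_rank_twist) (hS31 : bsdTriple_of_analyticRank_le_one_of_conductor_lt)
    (hcm : ¬ V.HasCM) (hr : V.analyticRank = 0) (h2 : ∀ Q : V.toAffine.Point, 2 • Q = 0 → Q = 0)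
    (K : Type) [Field K] [NumberField K] (hK : IsImaginaryQuadratic K) (hH : SatisfiesHeegnerHypothesis (V.conductorNorm ℤ) K)
    (Dt : ModularParametrizationData V (V.conductorNorm ℤ)) (H : HeegnerDatum (V.conductorNorm ℤ) (NumberField.discr K))
    (ι : K →+* ℂ) (P : (V.baseChange K).toAffine.Point) (hP : WeierstrassCurve.Affine.Point.map ι.toRatAlgHom P = heegnerPointComplex Dt H)
    (j : K →ₐ[ℚ] ℚ_[2]) (hstar : KrizLi2019.AssumptionStar V Dt K P j)
    (W₀ : WeierstrassCurve ℚ) [W₀.IsElliptic] [W₀.IsGloballyMinimal]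
    (hW₀ : ∃ C : VariableChange ℚ, C • V.quadraticTwist (NumberField.discr K : ℚ) = W₀) (hN₀ : W₀.conductorNorm ℤ < 5000) :
    W₀.analyticRank = 1 ∧ ¬ W₀.HasCM ∧ BSDp W₀ 2 := by
  have hD : (NumberField.discr K : ℚ) ≠ 0 := by exact_mod_cast NumberField.discr_ne_zero K
  exact ⟨krizLi_analyticRank_partner_eq_one_of_rankZero V h33 h2 K hK hH Dt H ι P hP j hstar hr W₀ hW₀,
    not_hasCM_of_smul_quadraticTwist V hcm hD W₀ hW₀,
    krizLi_bsdp_two_partner_of_conductor_lt V h33 hS31 h2 K hK hH Dt H ι P hP j hstar W₀ hW₀ hN₀⟩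

end Summit.BirchSwinnertonDyer.BirchSwinnertonDyer.Theorems.GenusExact.TwinSwap.KrizLiAnchorWall

end
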